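import Summits.ABC.StewartYu.RecordExitsNumeric
import HarnessLib

/-!
# Cell abc-stewartyu, Gen-3 record (WP-M3.R): exit A of the record from FIVE scalar facts — record-agnostic
# `(K1)`, `(K2)` (for the v2 family `PadicG3ParG` and any later re-instantiation)

`Summits/ABC/StewartYu/RecordExitsGeneric.lean` — cell `abc-stewartyu` (HOME `run/shared/lean/pub/abc-stewartyu/`),
route `PadicPrimesKummerThird`, cruxes `Y07Odd` (stmt-ABC-19658) / `Y07Two` (stmt-ABC-19659); seat lp-1 (g2).
Theorems only.

`PadicG3Exits.K1/K2/exitA` (p480190) prove exit A for the v1 record from its definitions.  The proofs use only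
five scalar facts about the END data `(L, S₀, X, X_fin, D₀)` — isolated here so that the gain-divided v2 record
(`PadicG3ParG`, scale `Lg`; plan g8 2026-08-27T02:41:30Z, p1 02:52:06Z) and any later variant instantiate exit A
in three lines:

* `K1_of` — `2^{n+24} ≤ L`, `16(n+1)L < (S₀+1)(n+2)⁴` ⟹ `2n(n+1)(⌊L/2^{n+22}⌋+1) ≤ S₀+1`;
* `K2_of` — additionally `1 ≤ X`, `D₀ ≤ X·L/4 + 2`, `2^{n+22}X ≤ X_fin` ⟹ `(n+1)²D₀ < (S₀+1)(2X_fin+1)`;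
* `exitA_of` — the `hA` hypothesis of `RecordAssembly.recordTwo_of_ineqs`/`recordOdd_of_ineqs` with
  `Dmax := ⌊L/2^{n+22}⌋ + 1`, from the five facts.

References: Yu. V. Nesterenko, LNM 1819 (2003), §5.2 (5.13)–(5.17), Lemma 5.3.
-/

namespace Summit.ABC.StewartYu

namespace RecordExitsNumeric

open Finset Nat

/-- **(K1) from two facts**: `2^{n+24} ≤ L` and `16(n+1)L < (S₀+1)(n+2)⁴` give
`2n(n+1)(⌊L/2^{n+22}⌋ + 1) ≤ S₀ + 1`. [cite: Nesterenko2003, §5.2 (5.13)–(5.14)] -/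
theorem K1_of {n L S₀ : ℕ} (hL : 2 ^ (n + 24) ≤ L) (hS : 16 * (n + 1) * L < (S₀ + 1) * (n + 2) ^ 4) :
    2 * n * (n + 1) * (L / 2 ^ (n + 22) + 1) ≤ S₀ + 1 := by
  have hq4 : 4 ≤ L / 2 ^ (n + 22) := by
    rw [Nat.le_div_iff_mul_le (by positivity)]
    calc 4 * 2 ^ (n + 22) = 2 ^ (n + 24) := by ring
      _ ≤ L := hL
  have hqL : L / 2 ^ (n + 22) * 2 ^ (n + 22) ≤ L := Nat.div_mul_le_self _ _
  have hpoly := mul_pow_four_le_two_pow n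
  have hmain : 2 * n * (n + 1) * (L / 2 ^ (n + 22) + 1) * (n + 2) ^ 4 ≤ 16 * (n + 1) * L := by
    generalize L / 2 ^ (n + 22) = q at hq4 hqL ⊢
    calc 2 * n * (n + 1) * (q + 1) * (n + 2) ^ 4
        ≤ 2 * n * (n + 1) * (2 * q) * (n + 2) ^ 4 := by gcongr; omega
      _ = 4 * (n + 1) * q * (n * (n + 2) ^ 4) := by ring
      _ ≤ 4 * (n + 1) * q * 2 ^ (n + 24) := Nat.mul_le_mul_left _ hpoly
      _ = 16 * (n + 1) * (q * 2 ^ (n + 22)) := by ring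
      _ ≤ 16 * (n + 1) * L := Nat.mul_le_mul_left _ hqL
  have h4 : 0 < (n + 2) ^ 4 := Nat.pow_pos (by omega)
  exact (Nat.lt_of_mul_lt_mul_right (lt_of_le_of_lt hmain hS)).le

/-- **(K2) from five facts**: `1 ≤ X`, `2^{n+24} ≤ L`, `D₀ ≤ X·L/4 + 2`, `2^{n+22}X ≤ X_fin`,
`16(n+1)L < (S₀+1)(n+2)⁴` give `(n+1)²·D₀ < (S₀+1)·(2X_fin+1)`. [cite: Nesterenko2003, §5.2 Lemma 5.3 (5.15)–(5.16)] -/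
theorem K2_of {n D₀ S₀ X Xf L : ℕ} (hX : 1 ≤ X) (hL : 2 ^ (n + 24) ≤ L)
    (hD₀ : (D₀ : ℝ) ≤ (X : ℝ) * L / 4 + 2) (hXf : 2 ^ (n + 22) * X ≤ Xf)
    (hS : 16 * (n + 1) * L < (S₀ + 1) * (n + 2) ^ 4) :
    (n + 1) ^ 2 * D₀ < (S₀ + 1) * (2 * Xf + 1) := by
  have hpoly : ((n + 1 : ℕ) : ℝ) * ((n + 2 : ℕ) : ℝ) ^ 4 ≤ (2 : ℝ) ^ (n + 24) := by
    exact_mod_cast succ_mul_pow_four_le_two_pow n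
  have hS' : (16 : ℝ) * (n + 1) * L < (S₀ + 1) * ((n + 2 : ℕ) : ℝ) ^ 4 := by exact_mod_cast hS
  have hXf' : (2 : ℝ) ^ (n + 22) * X ≤ Xf := by exact_mod_cast hXf
  have hX1 : (1 : ℝ) ≤ X := by exact_mod_cast hX
  have hL' : (2 : ℝ) ^ (n + 24) ≤ L := by exact_mod_cast hL
  have h224 : (2 : ℝ) ^ 24 ≤ 2 ^ (n + 24) := pow_le_pow_right₀ (by norm_num) (by omega)
  have hXL : (2 : ℝ) ^ 24 ≤ (X : ℝ) * L := by nlinarith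
  have hD₀' : (D₀ : ℝ) ≤ (X : ℝ) * L / 2 := by nlinarith
  have hn2 : (0 : ℝ) < ((n + 2 : ℕ) : ℝ) ^ 4 := by positivity
  have key : ((n + 1 : ℕ) : ℝ) ^ 2 * D₀ < (S₀ + 1) * (2 * Xf + 1) := by
    have h1 : ((n + 1 : ℕ) : ℝ) ^ 2 * D₀ * ((n + 2 : ℕ) : ℝ) ^ 4 ≤
        ((n + 1 : ℕ) : ℝ) * (2 : ℝ) ^ (n + 24) * ((X : ℝ) * L / 2) := by
      calc ((n + 1 : ℕ) : ℝ) ^ 2 * D₀ * ((n + 2 : ℕ) : ℝ) ^ 4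
          = ((n + 1 : ℕ) : ℝ) * (((n + 1 : ℕ) : ℝ) * ((n + 2 : ℕ) : ℝ) ^ 4) * D₀ := by ring
        _ ≤ ((n + 1 : ℕ) : ℝ) * (2 : ℝ) ^ (n + 24) * ((X : ℝ) * L / 2) := by
            have hD0 : (0 : ℝ) ≤ D₀ := by positivity
            gcongr
    have h2 : ((n + 1 : ℕ) : ℝ) * (2 : ℝ) ^ (n + 24) * ((X : ℝ) * L / 2) =
        (16 * (n + 1) * (L : ℝ)) * (2 ^ (n + 22) * (X : ℝ)) / 8 := by
      push_cast; rw [pow_add, pow_add]; ring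
    have h3 : (16 * ((n : ℝ) + 1) * L) * (2 ^ (n + 22) * (X : ℝ)) <
        ((S₀ : ℝ) + 1) * ((n + 2 : ℕ) : ℝ) ^ 4 * Xf := by
      have hpos : (0 : ℝ) < 2 ^ (n + 22) * (X : ℝ) := by positivity
      calc (16 * ((n : ℝ) + 1) * L) * (2 ^ (n + 22) * (X : ℝ))
          < ((S₀ : ℝ) + 1) * ((n + 2 : ℕ) : ℝ) ^ 4 * (2 ^ (n + 22) * (X : ℝ)) :=
            mul_lt_mul_of_pos_right hS' hpos
        _ ≤ ((S₀ : ℝ) + 1) * ((n + 2 : ℕ) : ℝ) ^ 4 * Xf :=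
            mul_le_mul_of_nonneg_left hXf' (by positivity)
    have h4 : ((n + 1 : ℕ) : ℝ) ^ 2 * D₀ * ((n + 2 : ℕ) : ℝ) ^ 4 <
        (S₀ + 1) * (2 * Xf + 1) * ((n + 2 : ℕ) : ℝ) ^ 4 := by
      have hXf0 : (0 : ℝ) ≤ Xf := by positivity
      have hS0 : (0 : ℝ) ≤ (S₀ : ℝ) + 1 := by positivity
      calc ((n + 1 : ℕ) : ℝ) ^ 2 * D₀ * ((n + 2 : ℕ) : ℝ) ^ 4
          ≤ (16 * (n + 1) * (L : ℝ)) * (2 ^ (n + 22) * (X : ℝ)) / 8 := by rw [← h2]; exact h1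
        _ < ((S₀ : ℝ) + 1) * ((n + 2 : ℕ) : ℝ) ^ 4 * Xf / 8 := by
            push_cast at h3 ⊢; linarith
        _ ≤ (S₀ + 1) * (2 * Xf + 1) * ((n + 2 : ℕ) : ℝ) ^ 4 := by
            rw [div_le_iff₀ (by norm_num : (0:ℝ) < 8)]
            nlinarith [mul_nonneg hS0 hXf0, mul_nonneg (mul_nonneg hS0 hXf0) hn2.le]
    exact lt_of_mul_lt_mul_right h4 hn2.le
  exact_mod_cast key

/-- **Exit A from the five scalar facts** (`Dmax := ⌊L/2^{n+22}⌋ + 1`): hypothesis `hA` of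
`RecordAssembly.recordTwo_of_ineqs` / `recordOdd_of_ineqs`. [cite: Nesterenko2003, §5.2 Lemma 5.3] -/
theorem exitA_of {n D₀ S₀ X Xf L : ℕ} (hX : 1 ≤ X) (hD₀1 : 1 ≤ D₀) (hL : 2 ^ (n + 24) ≤ L)
    (hD₀ : (D₀ : ℝ) ≤ (X : ℝ) * L / 4 + 2) (hXf : 2 ^ (n + 22) * X ≤ Xf)
    (hS : 16 * (n + 1) * L < (S₀ + 1) * (n + 2) ^ 4) :
    ∀ r d₀ : ℕ, r ≤ n → d₀ ≤ 1 →
      (n + 1).factorial * 2 ^ n * D₀ * (L / 2 ^ (n + 22) + 1) ^ r <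
        Nat.choose (S₀ + (r + 1 - d₀)) (r + 1 - d₀) * (2 * Xf + 1) *
          ((d₀ + (n - r)).factorial * 2 ^ (n - r) * D₀ ^ d₀) := by
  have hXf1 : 1 ≤ Xf := (hX.trans (Nat.le_mul_of_pos_left X (Nat.two_pow_pos _))).trans hXf
  exact exitA_of_bounds hXf1 hD₀1 (K1_of hL hS) (K2_of hX hL hD₀ hXf hS)

end RecordExitsNumeric

end Summit.ABC.StewartYu
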